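import Literature.NumberTheory.LFunctions.SoundZeroSideSums
import Literature.NumberTheory.LFunctions.SchoenfeldZeroSums
import Literature.NumberTheory.LFunctions.ZetaOrdinateDictionary
import Literature.NumberTheory.LFunctions.MontgomeryZeroSideProofs
import HarnessLib

/-!
# Window bounds for weighted sums over the zeros of `ζ` (Balazard–de Roton 2008, §2.3–2.4)

Topic `Literature/NumberTheory/LFunctions`. Everything here is PROVED. The device of
M. Balazard, A. de Roton, arXiv:0810.3587, proofs of Props. 7 and 8: a non-negative weight `w(γ)`,
decreasing in `|t − γ|`, summed over the zeros with multiplicity, is bounded by grouping the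
ordinates into windows of length `h` around `t` (whose zero counts `N(u+h) − N(u)` are controlled
by the typicality conditions) plus a tail `|t − γ| ≥ Kh` controlled by the local density
`Σ_ρ m(ρ)/(1 + (t−γ)²) ≪ log(|t|+2)` (`Montgomery.exists_density_le` through the ordinate
dictionary `tsum_nontrivialZeros_eq_tsum_zetaOrdinate`).

* `SoundTest.exists_tsum_zeroOrder_div_one_add_sq_le` — `Σ_ρ m(ρ)/(1+(t−γ)²) ≤ A log(|t|+2)`;
* `SoundTest.sum_windows_le` — `Σ_{t−Kh < γ ≤ t+Kh} m(ρ) w(γ) ≤ 2B Σ_{j<K} W_j` when every window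
  of length `h` inside carries at most `B` zeros and `w ≤ W_j` on `|t−γ| ≥ jh`;
* `SoundTest.tsum_zeroOrder_mul_le_windows_add_tail` — the resulting bound for the full sum.

## References

* [BalazardDeRoton2008] M. Balazard, A. de Roton, arXiv:0810.3587, Props. 7–8 (proofs). [cite: BalazardDeRoton2008, Props. 7 and 8 (proofs)]
-/

noncomputable section

open Complex Filter Set Topology
open scoped Real

namespace Literature.NumberTheory.LFunctions

namespace SoundTest

open SchoenfeldBound

/-- Short name for the subtype of non-trivial zeros. -/
local notation "𝒵" => ZetaZeros.riemannZetaNontrivialZeros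

/-! ## The local density `Σ_ρ m(ρ)/(1 + (t−γ)²) ≪ log(|t|+2)` -/

/-- **`Σ_ρ m(ρ)/(1+(t−γ)²) ≤ A log(|t|+2)`** for all real `t` (from `N(a+1) − N(a) ≪ log(a+2)`).
[cite: Titchmarsh1986, Thm. 9.2] -/
theorem exists_tsum_zeroOrder_div_one_add_sq_le :
    ∃ A : ℝ, 0 < A ∧ ∀ t : ℝ,
      ∑' ρ : 𝒵, (riemannZetaZeroOrder (ρ : ℂ) : ℝ) / (1 + (t - (ρ : ℂ).im) ^ 2) ≤ A * Real.log (|t| + 2) := by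
  obtain ⟨A₁, hA₁, hD⟩ := Montgomery.exists_density_le
  refine ⟨2 * A₁, by positivity, fun t ↦ ?_⟩
  set g : ℝ → ℂ := fun y ↦ ((1 / (1 + (t - y) ^ 2) : ℝ) : ℂ) with hg
  -- summability of the zero side (real and complex forms)
  have hreal : Summable fun ρ : 𝒵 ↦ (riemannZetaZeroOrder (ρ : ℂ) : ℝ) / (1 + (t - (ρ : ℂ).im) ^ 2) := by
    have hS := (ZetaZeroSum.summable_zeroOrder_div_one_add_sq).mul_left (2 * (1 + t ^ 2))
    refine Summable.of_nonneg_of_le (fun ρ ↦ div_nonneg (zeroOrder_nonneg ρ) (by positivity)) (fun ρ ↦ ?_) hS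
    have h := OrdinateDictionary.one_div_one_add_sq_sub_le t (ρ : ℂ).im
    have hm := zeroOrder_nonneg ρ
    calc (riemannZetaZeroOrder (ρ : ℂ) : ℝ) / (1 + (t - (ρ : ℂ).im) ^ 2)
        = (riemannZetaZeroOrder (ρ : ℂ) : ℝ) * (1 / (1 + (t - (ρ : ℂ).im) ^ 2)) := by ring
      _ ≤ (riemannZetaZeroOrder (ρ : ℂ) : ℝ) * (2 * (1 + t ^ 2) / (1 + (ρ : ℂ).im ^ 2)) :=
          mul_le_mul_of_nonneg_left h hm
      _ = 2 * (1 + t ^ 2) * ((riemannZetaZeroOrder (ρ : ℂ) : ℝ) / (1 + (ρ : ℂ).im ^ 2)) := by ring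
  have hA : Summable fun ρ : 𝒵 ↦ (riemannZetaZeroOrder (ρ : ℂ) : ℂ) * g (ρ : ℂ).im := by
    have := (Complex.ofRealCLM.summable hreal)
    refine this.congr fun ρ ↦ ?_
    simp [hg]; ring
  obtain ⟨hs1, hb1⟩ := hD t
  obtain ⟨hs2, hb2⟩ := hD (-t)
  have e2 : ∀ n : ℕ, 1 / (1 + (-t - zetaOrdinate n) ^ 2) = 1 / (1 + (t - -zetaOrdinate n) ^ 2) := fun n ↦ by
    ring
  have hB : Summable fun n : ℕ ↦ g (zetaOrdinate n) + g (-zetaOrdinate n) := by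
    have := Complex.ofRealCLM.summable (hs1.add (hs2.congr e2))
    refine this.congr fun n ↦ ?_
    simp [hg]
  have hdict := tsum_nontrivialZeros_eq_tsum_zetaOrdinate g hA hB
  -- take real parts
  have hl : (∑' ρ : 𝒵, (riemannZetaZeroOrder (ρ : ℂ) : ℂ) * g (ρ : ℂ).im) =
      ((∑' ρ : 𝒵, (riemannZetaZeroOrder (ρ : ℂ) : ℝ) / (1 + (t - (ρ : ℂ).im) ^ 2) : ℝ) : ℂ) := by
    rw [Complex.ofReal_tsum]
    refine tsum_congr fun ρ ↦ ?_
    simp [hg]; ring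
  have hr : (∑' n : ℕ, (g (zetaOrdinate n) + g (-zetaOrdinate n))) =
      ((∑' n : ℕ, (1 / (1 + (t - zetaOrdinate n) ^ 2) + 1 / (1 + (-t - zetaOrdinate n) ^ 2)) : ℝ) : ℂ) := by
    rw [Complex.ofReal_tsum]
    refine tsum_congr fun n ↦ ?_
    simp [hg]; ring
  rw [hl, hr] at hdict
  have hdict' := Complex.ofReal_injective hdict
  rw [hdict', (hs1).tsum_add (hs2.congr e2 |>.congr fun n ↦ (e2 n).symm)]
  have : Real.log (|-t| + 2) = Real.log (|t| + 2) := by rw [abs_neg]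
  rw [this] at hb2
  linarith

/-! ## Splitting `zerosBetween` and window counts -/

/-- `zerosBetween a c = zerosBetween a b ∪ zerosBetween b c` for `0 ≤ a ≤ b ≤ c`, disjointly. [folklore] -/
theorem zerosBetween_split {a b c : ℝ} (h0 : 0 ≤ a) (hab : a ≤ b) (hbc : b ≤ c) :
    zerosBetween a c = zerosBetween a b ∪ zerosBetween b c ∧ Disjoint (zerosBetween a b) (zerosBetween b c) := by
  have hb0 : 0 ≤ b := h0.trans hab
  constructor
  · ext ρ
    rw [Finset.mem_union, mem_zerosBetween h0, mem_zerosBetween h0, mem_zerosBetween hb0]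
    constructor
    · rintro ⟨hz, h1, h2, h3, h4⟩
      by_cases hb : ρ.im ≤ b
      · exact Or.inl ⟨hz, h1, h2, h3, hb⟩
      · exact Or.inr ⟨hz, h1, h2, not_le.1 hb, h4⟩
    · rintro (⟨hz, h1, h2, h3, h4⟩ | ⟨hz, h1, h2, h3, h4⟩)
      · exact ⟨hz, h1, h2, h3, h4.trans hbc⟩
      · exact ⟨hz, h1, h2, lt_of_le_of_lt hab h3, h4⟩
  · rw [Finset.disjoint_left]
    intro ρ h1 h2
    rw [mem_zerosBetween h0] at h1
    rw [mem_zerosBetween hb0] at h2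
    linarith [h1.2.2.2.2, h2.2.2.2.1]

/-- Sum splitting over `zerosBetween`. [folklore] -/
theorem sum_zerosBetween_split {a b c : ℝ} (h0 : 0 ≤ a) (hab : a ≤ b) (hbc : b ≤ c) (f : ℂ → ℝ) :
    ∑ ρ ∈ zerosBetween a c, f ρ = ∑ ρ ∈ zerosBetween a b, f ρ + ∑ ρ ∈ zerosBetween b c, f ρ := by
  obtain ⟨h1, h2⟩ := zerosBetween_split h0 hab hbc
  rw [h1, Finset.sum_union h2]

/-- **One window**: if `w(Im ρ) ≤ W` on `zerosBetween a b` (`0 ≤ a ≤ b`) then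
`Σ_{a < Im ρ ≤ b} m(ρ) w(Im ρ) ≤ W (N(b) − N(a))`. [folklore] -/
theorem sum_zerosBetween_le_count {a b : ℝ} (h0 : 0 ≤ a) (hab : a ≤ b) {w : ℝ → ℝ} {W : ℝ}
    (hw : ∀ ρ ∈ zerosBetween a b, w ρ.im ≤ W) :
    ∑ ρ ∈ zerosBetween a b, (riemannZetaZeroOrder ρ : ℝ) * w ρ.im ≤ W * ((zetaZeroCount b : ℝ) - zetaZeroCount a) := by
  rw [zetaZeroCount_sub_eq_sum hab, Finset.mul_sum]
  refine Finset.sum_le_sum fun ρ hρ ↦ ?_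
  rw [mul_comm W]
  exact mul_le_mul_of_nonneg_left (hw ρ hρ) (zeroOrder_nonneg_of_mem_zerosBetween h0 hρ)

/-- **The window sum** (BR, proofs of Props. 7–8): with `K` windows of length `h` on each side of
`t` (`t − Kh ≥ 0`), a non-negative weight `w` with `w(γ) ≤ W_j` whenever `|t − γ| ≥ jh`
(`W_j ≥ 0`), and at most `B ≥ 0` zeros (with multiplicity) in every window `]u, u+h]` inside
`[t − Kh, t + Kh]`: `Σ_{t−Kh < γ ≤ t+Kh} m(ρ) w(γ) ≤ 2B Σ_{j<K} W_j`. [cite: BalazardDeRoton2008, Prop. 7 (proof)] -/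
theorem sum_windows_le {t h : ℝ} (hh : 0 < h) {w : ℝ → ℝ} {Wj : ℕ → ℝ} (hWj0 : ∀ j, 0 ≤ Wj j)
    (hW : ∀ (j : ℕ) (y : ℝ), (j : ℝ) * h ≤ |t - y| → w y ≤ Wj j) {B : ℝ} :
    ∀ K : ℕ, 0 ≤ t - K * h →
      (∀ u : ℝ, t - K * h ≤ u → u + h ≤ t + K * h → (zetaZeroCount (u + h) : ℝ) - zetaZeroCount u ≤ B) →
      ∑ ρ ∈ zerosBetween (t - K * h) (t + K * h), (riemannZetaZeroOrder ρ : ℝ) * w ρ.im ≤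
        2 * B * ∑ j ∈ Finset.range K, Wj j := by
  intro K
  induction K with
  | zero =>
    intro _ _
    simp only [Nat.cast_zero, zero_mul, sub_zero, add_zero, Finset.range_zero, Finset.sum_empty, mul_zero]
    have : zerosBetween t t = ∅ := by
      ext ρ
      simp only [Finset.notMem_empty, iff_false]
      intro hρ
      by_cases ht : 0 ≤ t
      · rw [mem_zerosBetween ht] at hρ; linarith [hρ.2.2.2.1, hρ.2.2.2.2]
      · -- `t < 0`: membership forces `t < Im ρ ≤ t`
        simp only [zerosBetween, Set.Finite.mem_toFinset, Set.mem_sdiff] at hρ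
        exact hρ.2 hρ.1
    rw [this, Finset.sum_empty]
  | succ K ih =>
    intro h0 hB
    push_cast at h0 hB ⊢
    have h0' : 0 ≤ t - K * h := by nlinarith
    have hKh : 0 ≤ (K : ℝ) * h := by positivity
    -- split off the two outer windows
    have e1 : t - (K + 1) * h ≤ t - K * h := by nlinarith
    have e2 : t - K * h ≤ t + K * h := by linarith
    have e3 : t + K * h ≤ t + (K + 1) * h := by nlinarith
    rw [sum_zerosBetween_split h0 e1 (e2.trans e3), sum_zerosBetween_split h0' e2 e3]
    have hIH := ih h0' (fun u hu1 hu2 ↦ hB u (by linarith) (by linarith))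
    -- outer windows: `|t − γ| ≥ K h`, counts `≤ B`
    have hleft : ∑ ρ ∈ zerosBetween (t - (K + 1) * h) (t - K * h), (riemannZetaZeroOrder ρ : ℝ) * w ρ.im ≤ Wj K * B := by
      refine (sum_zerosBetween_le_count h0 e1 fun ρ hρ ↦ hW K ρ.im ?_).trans ?_
      · rw [mem_zerosBetween h0] at hρ
        rw [abs_of_nonneg (by linarith [hρ.2.2.2.2])]; linarith [hρ.2.2.2.2]
      · refine mul_le_mul_of_nonneg_left ?_ (hWj0 K)
        have := hB (t - (K + 1) * h) le_rfl (by nlinarith)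
        have e : t - (K + 1) * h + h = t - K * h := by ring
        rwa [e] at this
    have hright : ∑ ρ ∈ zerosBetween (t + K * h) (t + (K + 1) * h), (riemannZetaZeroOrder ρ : ℝ) * w ρ.im ≤ Wj K * B := by
      refine (sum_zerosBetween_le_count (by linarith) e3 fun ρ hρ ↦ hW K ρ.im ?_).trans ?_
      · rw [mem_zerosBetween (by linarith)] at hρ
        rw [abs_of_nonpos (by linarith [hρ.2.2.2.1])]; linarith [hρ.2.2.2.1]
      · refine mul_le_mul_of_nonneg_left ?_ (hWj0 K)
        have := hB (t + K * h) (by linarith) (by nlinarith)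
        have e : t + K * h + h = t + (K + 1) * h := by ring
        rwa [e] at this
    rw [Finset.sum_range_succ]
    nlinarith [hleft, hright, hIH, hWj0 K]

/-! ## From the full sum over the zeros to windows plus tail -/

/-- **Windows plus tail**: for a non-negative weight `w` as in `sum_windows_le` which moreover
satisfies `w(γ) ≤ C₀/(1+(t−γ)²)` for `|t−γ| ≥ Kh`, and such that `ρ ↦ m(ρ) w(Im ρ)` is summable,
`Σ_ρ m(ρ) w(Im ρ) ≤ 2B Σ_{j<K} W_j + C₀ Σ_ρ m(ρ)/(1+(t−γ)²)`. [cite: BalazardDeRoton2008, Prop. 7 (proof)] -/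
theorem tsum_zeroOrder_mul_le_windows_add_tail {t h : ℝ} (hh : 0 < h) {w : ℝ → ℝ} (hw0 : ∀ y, 0 ≤ w y)
    {Wj : ℕ → ℝ} (hWj0 : ∀ j, 0 ≤ Wj j) (hW : ∀ (j : ℕ) (y : ℝ), (j : ℝ) * h ≤ |t - y| → w y ≤ Wj j)
    {B : ℝ} {K : ℕ} (hK : 0 ≤ t - K * h)
    (hB : ∀ u : ℝ, t - K * h ≤ u → u + h ≤ t + K * h → (zetaZeroCount (u + h) : ℝ) - zetaZeroCount u ≤ B)
    {C₀ : ℝ} (hC₀ : 0 ≤ C₀) (htail : ∀ y : ℝ, (K : ℝ) * h ≤ |t - y| → w y ≤ C₀ / (1 + (t - y) ^ 2))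
    (hsum : Summable fun ρ : 𝒵 ↦ (riemannZetaZeroOrder (ρ : ℂ) : ℝ) * w (ρ : ℂ).im) :
    ∑' ρ : 𝒵, (riemannZetaZeroOrder (ρ : ℂ) : ℝ) * w (ρ : ℂ).im ≤
      2 * B * ∑ j ∈ Finset.range K, Wj j +
        C₀ * ∑' ρ : 𝒵, (riemannZetaZeroOrder (ρ : ℂ) : ℝ) / (1 + (t - (ρ : ℂ).im) ^ 2) := by
  classical
  set S : Finset 𝒵 := (zerosBetween (t - K * h) (t + K * h)).subtype (· ∈ 𝒵) with hS
  set f : 𝒵 → ℝ := fun ρ ↦ (riemannZetaZeroOrder (ρ : ℂ) : ℝ) * w (ρ : ℂ).im with hf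
  have hf0 : ∀ ρ, 0 ≤ f ρ := fun ρ ↦ mul_nonneg (zeroOrder_nonneg ρ) (hw0 _)
  -- split the sum along `S`
  rw [← hsum.sum_add_tsum_subtype_compl S]
  -- the finite part is the window sum
  have hfin : ∑ ρ ∈ S, f ρ = ∑ ρ ∈ zerosBetween (t - K * h) (t + K * h), (riemannZetaZeroOrder ρ : ℝ) * w ρ.im := by
    have h1 := Finset.sum_subtype_eq_sum_filter (s := zerosBetween (t - K * h) (t + K * h)) (p := (· ∈ 𝒵))
      (fun z : ℂ ↦ (riemannZetaZeroOrder z : ℝ) * w z.im)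
    rw [Finset.filter_true_of_mem (fun ρ hρ ↦
      (show ρ ∈ ZetaZeros.riemannZetaNontrivialZeros from mem_nontrivialZeros_of_mem_zerosBetween hK hρ))] at h1
    exact h1
  have hwin := sum_windows_le hh hWj0 hW K hK hB
  -- the tail
  have hdens : Summable fun ρ : 𝒵 ↦ (riemannZetaZeroOrder (ρ : ℂ) : ℝ) / (1 + (t - (ρ : ℂ).im) ^ 2) := by
    have hS' := (ZetaZeroSum.summable_zeroOrder_div_one_add_sq).mul_left (2 * (1 + t ^ 2))
    refine Summable.of_nonneg_of_le (fun ρ ↦ div_nonneg (zeroOrder_nonneg ρ) (by positivity)) (fun ρ ↦ ?_) hS'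
    have h1 := OrdinateDictionary.one_div_one_add_sq_sub_le t (ρ : ℂ).im
    have hm := zeroOrder_nonneg ρ
    calc (riemannZetaZeroOrder (ρ : ℂ) : ℝ) / (1 + (t - (ρ : ℂ).im) ^ 2)
        = (riemannZetaZeroOrder (ρ : ℂ) : ℝ) * (1 / (1 + (t - (ρ : ℂ).im) ^ 2)) := by ring
      _ ≤ (riemannZetaZeroOrder (ρ : ℂ) : ℝ) * (2 * (1 + t ^ 2) / (1 + (ρ : ℂ).im ^ 2)) :=
          mul_le_mul_of_nonneg_left h1 hm
      _ = 2 * (1 + t ^ 2) * ((riemannZetaZeroOrder (ρ : ℂ) : ℝ) / (1 + (ρ : ℂ).im ^ 2)) := by ring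
  have htail_le : ∑' ρ : {ρ : 𝒵 // ρ ∉ S}, f ρ ≤
      C₀ * ∑' ρ : 𝒵, (riemannZetaZeroOrder (ρ : ℂ) : ℝ) / (1 + (t - (ρ : ℂ).im) ^ 2) := by
    -- pointwise on the complement: `|t − γ| ≥ K h`
    have hpt : ∀ ρ : {ρ : 𝒵 // ρ ∉ S}, f ρ ≤ C₀ * ((riemannZetaZeroOrder ((ρ : 𝒵) : ℂ) : ℝ) /
        (1 + (t - ((ρ : 𝒵) : ℂ).im) ^ 2)) := by
      intro ρ
      have hnot : ((ρ : 𝒵) : ℂ) ∉ zerosBetween (t - K * h) (t + K * h) := fun hmem ↦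
        ρ.2 (Finset.mem_subtype.2 hmem)
      have hz := ZetaZeros.riemannZetaNontrivialZeros.zeta_eq_zero (ρ : 𝒵).2
      have hre0 := ZetaZeros.riemannZetaNontrivialZeros.re_pos (ρ : 𝒵).2
      have hre1 := ZetaZeros.riemannZetaNontrivialZeros.re_lt_one (ρ : 𝒵).2
      have hfar : (K : ℝ) * h ≤ |t - ((ρ : 𝒵) : ℂ).im| := by
        by_contra hlt
        rw [not_le, abs_lt] at hlt
        exact hnot ((mem_zerosBetween hK).2 ⟨hz, hre0.le, hre1.le, by linarith [hlt.2], by linarith [hlt.1]⟩)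
      have := mul_le_mul_of_nonneg_left (htail _ hfar) (zeroOrder_nonneg (ρ : 𝒵))
      simp only [hf]
      calc (riemannZetaZeroOrder ((ρ : 𝒵) : ℂ) : ℝ) * w ((ρ : 𝒵) : ℂ).im
          ≤ (riemannZetaZeroOrder ((ρ : 𝒵) : ℂ) : ℝ) * (C₀ / (1 + (t - ((ρ : 𝒵) : ℂ).im) ^ 2)) := this
        _ = _ := by ring
    have hsub : Summable fun ρ : {ρ : 𝒵 // ρ ∉ S} ↦ C₀ * ((riemannZetaZeroOrder ((ρ : 𝒵) : ℂ) : ℝ) /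
        (1 + (t - ((ρ : 𝒵) : ℂ).im) ^ 2)) := (hdens.mul_left C₀).subtype _
    calc ∑' ρ : {ρ : 𝒵 // ρ ∉ S}, f ρ
        ≤ ∑' ρ : {ρ : 𝒵 // ρ ∉ S}, C₀ * ((riemannZetaZeroOrder ((ρ : 𝒵) : ℂ) : ℝ) / (1 + (t - ((ρ : 𝒵) : ℂ).im) ^ 2)) :=
          (hsum.subtype _).tsum_le_tsum hpt hsub
      _ ≤ ∑' ρ : 𝒵, C₀ * ((riemannZetaZeroOrder (ρ : ℂ) : ℝ) / (1 + (t - (ρ : ℂ).im) ^ 2)) :=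
          Summable.tsum_subtype_le _ _ (fun ρ ↦ mul_nonneg hC₀ (div_nonneg (zeroOrder_nonneg ρ) (by positivity)))
            (hdens.mul_left C₀)
      _ = C₀ * ∑' ρ : 𝒵, (riemannZetaZeroOrder (ρ : ℂ) : ℝ) / (1 + (t - (ρ : ℂ).im) ^ 2) := tsum_mul_left
  rw [hfin]
  linarith

end SoundTest

end Literature.NumberTheory.LFunctions
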